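import Summits.QuantumAdvantage.AdviceFreeQNC0.TensorBlocks
import Summits.QuantumAdvantage.AdviceFreeQNC0.SPSApprox
import HarnessLib

/-!
# B10 (walk form): the ΣΠΣ_𝔽₂ payoff of `T10W`

Cell qa-qnc0 (crux α = `RingToElim`; planner qa-qnc0-p1's ROUND-12 §2.9 / TARGET §25.8, typed
companion `HOME/qa-qnc0-p1/Sketch13.lean` v3).  `T10W` (walk strategies of `𝔽₂`-degree `D` in the
linear window `n ≥ λD` win on at most `(1 - 2^{-cD})·2ⁿ` inputs, for some `c < 1`; OPEN) pays against
poly-size ΣΠΣ_𝔽₂ circuits through Razborov's lemma at AND-depth one (`spsApprox`, this directory):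
every walk strategy whose `n+1` cuts are XORs of `≤ n^a` ANDs of affine forms fails on at least
`2ⁿ/n^b` inputs.  Bookkeeping (the planner's recipe, constants made integral): with
`L = ⌊log₂ n⌋ + 1`, `K = ⌈1/(1-c₁)⌉` (`c₁ = max(c, 1/2)`), take `D = K(a+2)L`; the `n+1` degree-`D`
approximants disagree with the cuts on `≤ (n+1)·n^a·2^{n-D} ≤ 2^{n-c₁D}/2` inputs (as
`2^{(1-c₁)D} ≥ 2^{(a+2)L} ≥ (n+1)^{a+2} ≥ 2(n+1)n^a`), the walk win bit depends on the cuts only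
through their values at the same input, and `T10W` leaves `≥ 2^{n-c₁D}` failures for the
approximants; so `#fail ≥ 2^{n-c₁D-1} ≥ 2ⁿ/n^{2K(a+2)+1}` (as `2^{c₁D+1} ≤ 2^{D+1} ≤ n^{2K(a+2)+1}`),
for `n ≥ 2^{max(D₀, 2λK(a+2))} + 3` (which gives `D ≥ D₀` and `λD ≤ 2^{⌊log₂ n⌋} ≤ n`).

Main result: `b10W : B10W` (Sketch13 v3 VERBATIM statements `SPSWalkFailPoly`, `B10W`).
WHAT THIS IS NOT: `T10W` is a hypothesis (OPEN); this is the conditional payoff only; the ring-form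
transport `B10R` (via `WalkTransport`) is not in this file.  Separation NOT moved.
-/

noncomputable section

namespace Summit.QuantumAdvantage.AdviceFreeQNC0

open Finset

/-! ### Sketch13 v3 statements (verbatim) -/

/-- **ΣΠΣ hardness of the walk game, 1/poly gap**: for every size exponent `a` there are `b, n₀`
such that every walk strategy whose `n+1` cuts are ΣΠΣ_𝔽₂ circuits with `≤ n^a` AND gates fails
on at least `2^n / n^b` inputs (`n ≥ n₀`, every charge). -/
def SPSWalkFailPoly : Prop :=
  ∀ a : ℕ, ∃ b n₀ : ℕ, ∀ n ≥ n₀, ∀ (ch : ℕ) (y : Fin (n + 1) → (Fin n → Bool) → Bool),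
    (∀ g, IsSPS (n ^ a) (y g)) →
      (2 : ℝ) ^ n ≤ (n : ℝ) ^ b *
        ((univ.filter fun u : Fin n → Bool => ringWinU ch y u = false).card : ℝ)

/-- **B10 (walk form)** — routine arithmetic (M-sized in Lean): given `T10W` with exponent `c < 1`
and window `n ≥ λD, D ≥ D₀`, and `SPSApprox`, take `D := ⌈((a+2)·log₂ n + 3)/(1-c)⌉`; the `n+1`
approximants `p_g` disagree with the cuts on `≤ (n+1)·n^a·2^{n-D} ≤ 2^{n-cD-1}` inputs in total,
`ringWinU ch y u = ringWinU ch p u` off that set, and `T10W` gives `#fail(p) ≥ 2^{n-cD}`; so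
`#fail(y) ≥ 2^{n-cD-1} ≥ 2^n / n^b` with `b := ⌈c(a+2)/(1-c)⌉ + 2`, `n ≥ n₀(a, c, λ, D₀)`. -/
def B10W : Prop := T10W → SPSApprox → SPSWalkFailPoly

namespace SPSWalkPayoff

/-- Linear is eventually below exponential: `C·(m+1) ≤ 2^m` once `m ≥ 2C`. [folklore] -/
theorem mul_succ_le_two_pow (C : ℕ) : ∀ m, 2 * C ≤ m → C * (m + 1) ≤ 2 ^ m := by
  have base : C * (2 * C + 1) ≤ 2 ^ (2 * C) := by
    induction C with
    | zero => simp
    | succ C ih =>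
      have h4 : 2 * C < 2 ^ (2 * C) := Nat.lt_two_pow_self
      have h1 : 1 ≤ 2 ^ (2 * C) := Nat.one_le_two_pow
      rw [show 2 * (C + 1) = 2 * C + 1 + 1 from by ring, pow_succ, pow_succ]
      nlinarith [ih, h4, h1]
  intro m hm
  induction m, hm using Nat.le_induction with
  | base => exact base
  | succ m hm ih =>
    rw [pow_succ]
    nlinarith [ih, hm]

/-- The walk win bit depends on the cuts only through their values at the same input. -/
theorem ringWinU_congr {n : ℕ} (ch : ℕ) {y p : Fin (n + 1) → (Fin n → Bool) → Bool}
    {u : Fin n → Bool} (h : ∀ g, p g u = y g u) : ringWinU ch y u = ringWinU ch p u := by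
  unfold ringWinU
  have : (univ.filter fun g : Fin (n + 1) => y g u = true ∧ (ch + g.val + walkExp u g.val) % 3 ≠ 0) =
      univ.filter fun g : Fin (n + 1) => p g u = true ∧ (ch + g.val + walkExp u g.val) % 3 ≠ 0 :=
    filter_congr fun g _ => by rw [h g]
  rw [this]

/-- **B10 (walk form)**, proved: `T10W → SPSApprox → SPSWalkFailPoly`. -/
theorem _root_.Summit.QuantumAdvantage.AdviceFreeQNC0.b10W : B10W := by
  classical
  rintro ⟨c, hc1, lam, D₀, hW⟩ hS a
  -- WLOG the exponent is `c₁ = max(c, 1/2) ∈ [1/2, 1)`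
  set c₁ : ℝ := max c (1 / 2) with hc₁def
  have hc₁1 : c₁ < 1 := max_lt hc1 (by norm_num)
  have hcc₁ : c ≤ c₁ := le_max_left _ _
  have hc₁0 : 0 ≤ c₁ := le_trans (by norm_num) (le_max_right _ _)
  have h1c : 0 < 1 - c₁ := by linarith
  -- `K ≥ 1/(1-c₁)`
  obtain ⟨K, hK⟩ : ∃ K : ℕ, 1 ≤ (1 - c₁) * K := by
    refine ⟨⌈1 / (1 - c₁)⌉₊, ?_⟩
    have h := Nat.le_ceil (1 / (1 - c₁))
    calc (1 : ℝ) = (1 - c₁) * (1 / (1 - c₁)) := by field_simp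
      _ ≤ (1 - c₁) * (⌈1 / (1 - c₁)⌉₊ : ℝ) := mul_le_mul_of_nonneg_left h h1c.le
  have hK1 : 1 ≤ K := by
    rcases Nat.eq_zero_or_pos K with h | h
    · rw [h, Nat.cast_zero, mul_zero] at hK; norm_num at hK
    · exact h
  -- exponents: `D = E·L`, `b = 2E+1`, window constant `C = λE`
  set E : ℕ := K * (a + 2) with hE
  have hE1 : 1 ≤ E := le_trans hK1 (Nat.le_mul_of_pos_right K (by omega))
  set C : ℕ := lam * E with hC
  refine ⟨2 * E + 1, 2 ^ (max D₀ (2 * C)) + 3, fun n hn ch y hy => ?_⟩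
  have hn3 : 3 ≤ n := le_of_add_le_right hn
  have hnpow : 2 ^ (max D₀ (2 * C)) ≤ n := le_trans (Nat.le_add_right _ 3) hn
  have hn0 : n ≠ 0 := by omega
  -- `L = ⌊log₂ n⌋ + 1`: `2^{L-1} ≤ n < 2^L`
  set L : ℕ := Nat.log 2 n + 1 with hL
  have hLn : 2 ^ Nat.log 2 n ≤ n := Nat.pow_log_le_self 2 hn0
  have hnL : n < 2 ^ L := Nat.lt_pow_succ_log_self (by norm_num) n
  have hlogD₀ : D₀ ≤ Nat.log 2 n :=
    Nat.le_log_of_pow_le (by norm_num) ((Nat.pow_le_pow_right (by norm_num) (le_max_left _ _)).trans hnpow)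
  have hlogC : 2 * C ≤ Nat.log 2 n :=
    Nat.le_log_of_pow_le (by norm_num) ((Nat.pow_le_pow_right (by norm_num) (le_max_right _ _)).trans hnpow)
  set D : ℕ := E * L with hD
  have hLD : L ≤ D := by rw [hD]; exact Nat.le_mul_of_pos_left L hE1
  have hD₀D : D₀ ≤ D := hlogD₀.trans ((Nat.le_succ _).trans hLD)
  have hD1 : 1 ≤ D := le_trans (by omega) hLD
  have hlamD : lam * D ≤ n := by
    have h := mul_succ_le_two_pow C (Nat.log 2 n) hlogC
    calc lam * D = C * (Nat.log 2 n + 1) := by rw [hD, hC, hL, hE]; ring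
      _ ≤ 2 ^ Nat.log 2 n := h
      _ ≤ n := hLn
  -- the degree-`D` approximants of the `n+1` cuts
  have hp : ∀ g, ∃ p : (Fin n → Bool) → Bool, HasDeg p D ∧
      (univ.filter fun x : Fin n → Bool => p x ≠ y g x).card * 2 ^ D ≤ n ^ a * 2 ^ n :=
    fun g => hS n (n ^ a) D (y g) (hy g) hD1
  choose p hpdeg hperr using hp
  have hwin := hW D hD₀D n hlamD ch p hpdeg
  -- the bad set: inputs where some approximant disagrees with its cut
  set Bad : Finset (Fin n → Bool) := univ.filter fun u => ∃ g, p g u ≠ y g u with hBad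
  have hBad_le : Bad.card * 2 ^ D ≤ (n + 1) * (n ^ a * 2 ^ n) := by
    have hsub : Bad ⊆ (univ : Finset (Fin (n + 1))).biUnion fun g =>
        univ.filter fun u : Fin n → Bool => p g u ≠ y g u := by
      intro u hu
      rw [mem_filter] at hu
      obtain ⟨g, hg⟩ := hu.2
      exact mem_biUnion.2 ⟨g, mem_univ g, mem_filter.2 ⟨mem_univ u, hg⟩⟩
    calc Bad.card * 2 ^ D
        ≤ (∑ g : Fin (n + 1), (univ.filter fun u : Fin n → Bool => p g u ≠ y g u).card) * 2 ^ D :=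
          Nat.mul_le_mul_right _ ((card_le_card hsub).trans card_biUnion_le)
      _ = ∑ g : Fin (n + 1), (univ.filter fun u : Fin n → Bool => p g u ≠ y g u).card * 2 ^ D := by
          rw [sum_mul]
      _ ≤ ∑ _g : Fin (n + 1), n ^ a * 2 ^ n := sum_le_sum fun g _ => hperr g
      _ = (n + 1) * (n ^ a * 2 ^ n) := by rw [sum_const, card_univ, Fintype.card_fin, smul_eq_mul]
  -- failures of `p` are failures of `y` or bad inputs
  set failY : Finset (Fin n → Bool) := univ.filter fun u => ringWinU ch y u = false with hfailY
  set failP : Finset (Fin n → Bool) := univ.filter fun u => ringWinU ch p u = false with hfailP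
  have hfail : failP.card ≤ failY.card + Bad.card := by
    have hsub : failP ⊆ failY ∪ Bad := by
      intro u hu
      rw [mem_filter] at hu
      by_cases hb : u ∈ Bad
      · exact mem_union_right _ hb
      · refine mem_union_left _ (mem_filter.2 ⟨mem_univ u, ?_⟩)
        have hpy : ∀ g, p g u = y g u := fun g => by
          by_contra h
          exact hb (mem_filter.2 ⟨mem_univ u, g, h⟩)
        rw [ringWinU_congr ch hpy]
        exact hu.2
    exact (card_le_card hsub).trans (card_union_le _ _)
  have hcomp : failP.card + (univ.filter fun u : Fin n → Bool => ringWinU ch p u = true).card = 2 ^ n := by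
    have h := TensorBlocks.failCount_add_card_win (ringWinU ch p)
    unfold failCount at h
    exact h
  -- real arithmetic
  have hN : (0 : ℝ) < (2 : ℝ) ^ n := by positivity
  have hDpos : (0 : ℝ) < (2 : ℝ) ^ D := by positivity
  -- (i) the approximants fail on `≥ 2^{-c₁D}·2ⁿ` inputs
  have hfailP : (2 : ℝ) ^ (-(c₁ * (D : ℝ))) * (2 : ℝ) ^ n ≤ (failP.card : ℝ) := by
    have h1 : (failP.card : ℝ) =
        (2 : ℝ) ^ n - ((univ.filter fun u : Fin n → Bool => ringWinU ch p u = true).card : ℝ) := by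
      have := congrArg (fun m : ℕ => (m : ℝ)) hcomp
      push_cast at this
      linarith
    have h2 : (2 : ℝ) ^ (-(c₁ * (D : ℝ))) ≤ (2 : ℝ) ^ (-(c * (D : ℝ))) := by
      refine Real.rpow_le_rpow_of_exponent_le (by norm_num) ?_
      have := mul_le_mul_of_nonneg_right hcc₁ (Nat.cast_nonneg D : (0 : ℝ) ≤ D)
      linarith only [this]
    have h3 := mul_le_mul_of_nonneg_right h2 hN.le
    rw [h1]
    linarith only [hwin, h3]
  -- (ii) the bad set is at most half of that
  have hkeyNat : 2 * (n + 1) * n ^ a ≤ 2 ^ ((a + 2) * L) := by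
    calc 2 * (n + 1) * n ^ a ≤ (n + 1) ^ 2 * (n + 1) ^ a := by
          have h2 : 2 * (n + 1) ≤ (n + 1) ^ 2 := by nlinarith
          exact Nat.mul_le_mul h2 (Nat.pow_le_pow_left (Nat.le_succ n) a)
      _ = (n + 1) ^ (a + 2) := by ring
      _ ≤ (2 ^ L) ^ (a + 2) := Nat.pow_le_pow_left (Nat.succ_le_of_lt hnL) _
      _ = 2 ^ ((a + 2) * L) := by rw [← pow_mul, mul_comm]
  have hkey : (2 : ℝ) * (n + 1) * (n : ℝ) ^ a ≤ (2 : ℝ) ^ ((1 - c₁) * (D : ℝ)) := by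
    have h1 : ((2 * (n + 1) * n ^ a : ℕ) : ℝ) ≤ ((2 ^ ((a + 2) * L) : ℕ) : ℝ) := by
      exact_mod_cast hkeyNat
    push_cast at h1
    have h2 : (2 : ℝ) ^ ((a + 2) * L) ≤ (2 : ℝ) ^ ((1 - c₁) * (D : ℝ)) := by
      rw [← Real.rpow_natCast]
      refine Real.rpow_le_rpow_of_exponent_le (by norm_num) ?_
      have hDr : ((D : ℕ) : ℝ) = (K : ℝ) * ((a : ℝ) + 2) * (L : ℝ) := by
        rw [hD, hE]; push_cast; ring
      rw [hDr]
      push_cast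
      have hL0 : (0 : ℝ) ≤ ((a : ℝ) + 2) * (L : ℝ) := by positivity
      have h3 := mul_le_mul_of_nonneg_right hK hL0
      linarith only [h3]
    linarith only [h1, h2]
  have hBadR : 2 * (Bad.card : ℝ) ≤ (2 : ℝ) ^ (-(c₁ * (D : ℝ))) * (2 : ℝ) ^ n := by
    have h1 : (Bad.card : ℝ) * (2 : ℝ) ^ D ≤ ((n : ℝ) + 1) * ((n : ℝ) ^ a * (2 : ℝ) ^ n) := by
      exact_mod_cast hBad_le
    have h2 : (2 : ℝ) ^ (-(c₁ * (D : ℝ))) * (2 : ℝ) ^ D = (2 : ℝ) ^ ((1 - c₁) * (D : ℝ)) := by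
      rw [← Real.rpow_natCast, ← Real.rpow_add (by norm_num)]
      congr 1
      ring
    refine le_of_mul_le_mul_right ?_ hDpos
    calc 2 * (Bad.card : ℝ) * (2 : ℝ) ^ D = 2 * ((Bad.card : ℝ) * (2 : ℝ) ^ D) := by ring
      _ ≤ 2 * (((n : ℝ) + 1) * ((n : ℝ) ^ a * (2 : ℝ) ^ n)) := by linarith only [h1]
      _ = (2 * ((n : ℝ) + 1) * (n : ℝ) ^ a) * (2 : ℝ) ^ n := by ring
      _ ≤ (2 : ℝ) ^ ((1 - c₁) * (D : ℝ)) * (2 : ℝ) ^ n := mul_le_mul_of_nonneg_right hkey hN.le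
      _ = (2 : ℝ) ^ (-(c₁ * (D : ℝ))) * (2 : ℝ) ^ n * (2 : ℝ) ^ D := by rw [← h2]; ring
  -- (iii) hence `y` fails on `≥ 2^{-c₁D}·2ⁿ/2` inputs
  have hfailYR : (2 : ℝ) ^ (-(c₁ * (D : ℝ))) * (2 : ℝ) ^ n ≤ 2 * (failY.card : ℝ) := by
    have h1 : (failP.card : ℝ) ≤ (failY.card : ℝ) + (Bad.card : ℝ) := by exact_mod_cast hfail
    linarith only [hfailP, hBadR, h1]
  -- (iv) `2^{c₁D+1} ≤ n^b`
  have hnb : (2 : ℝ) ≤ (n : ℝ) ^ (2 * E + 1) * (2 : ℝ) ^ (-(c₁ * (D : ℝ))) := by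
    have hNat : 2 ^ (D + 1) ≤ n ^ (2 * E + 1) := by
      have h2L : 2 ^ L ≤ 2 * n := by rw [hL, pow_succ]; linarith
      calc 2 ^ (D + 1) = 2 * (2 ^ L) ^ E := by rw [hD, pow_succ, mul_comm E L, pow_mul]; ring
        _ ≤ 2 * (2 * n) ^ E := Nat.mul_le_mul_left _ (Nat.pow_le_pow_left h2L E)
        _ = 2 ^ (E + 1) * n ^ E := by rw [mul_pow]; ring
        _ ≤ n ^ (E + 1) * n ^ E :=
          Nat.mul_le_mul_right _ (Nat.pow_le_pow_left (show 2 ≤ n by omega) _)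
        _ = n ^ (2 * E + 1) := by rw [← pow_add]; ring_nf
    have hR : 2 * (2 : ℝ) ^ (c₁ * (D : ℝ)) ≤ (n : ℝ) ^ (2 * E + 1) := by
      have h1 : (2 : ℝ) ^ (c₁ * (D : ℝ)) ≤ (2 : ℝ) ^ ((D : ℕ) : ℝ) := by
        refine Real.rpow_le_rpow_of_exponent_le (by norm_num) ?_
        have := mul_le_mul_of_nonneg_right hc₁1.le (Nat.cast_nonneg D : (0 : ℝ) ≤ D)
        linarith only [this]
      rw [Real.rpow_natCast] at h1
      have h2 : ((2 ^ (D + 1) : ℕ) : ℝ) ≤ ((n ^ (2 * E + 1) : ℕ) : ℝ) := by exact_mod_cast hNat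
      push_cast at h2
      calc 2 * (2 : ℝ) ^ (c₁ * (D : ℝ)) ≤ 2 * (2 : ℝ) ^ D := by linarith only [h1]
        _ = (2 : ℝ) ^ (D + 1) := by ring
        _ ≤ (n : ℝ) ^ (2 * E + 1) := h2
    have hpos : (0 : ℝ) < (2 : ℝ) ^ (c₁ * (D : ℝ)) := Real.rpow_pos_of_pos (by norm_num) _
    rw [Real.rpow_neg (by norm_num), ← div_eq_mul_inv, le_div_iff₀ hpos]
    exact hR
  -- conclusion
  have hb0 : (0 : ℝ) ≤ (n : ℝ) ^ (2 * E + 1) := by positivity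
  have e1 := mul_le_mul_of_nonneg_left hfailYR hb0
  have e2 := mul_le_mul_of_nonneg_right hnb hN.le
  linarith only [e1, e2]

end SPSWalkPayoff

end Summit.QuantumAdvantage.AdviceFreeQNC0
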